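import Mathlib
import HarnessLib
import HarnessLib.Audit
import Summits.Langlands.Statement
import Literature.NumberTheory.Automorphic.HyperbolicLaplaceSpectrum
import Literature.NumberTheory.GaloisRepresentations.ArtinLFunction
import HarnessLib.Audit.Status.Attr

/-!
Route: RationalPeriodQuarter

Route RationalPeriodQuarter — realises idea card
Langlands/Langlands/rational-period-functions-quarter.

THESIS X (it suffices to show, for the λ = 1/4 sector of direction (A), n = 2, F = ℚ): the space
S(N) of Maass cusp
forms of Laplace eigenvalue 1/4 on Γ₁(N) has a HECKE-STABLE ℚ-FORM cut out by period cocycles — S(N)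
is spanned by
the forms v whose Lewis–Zagier/BLZ cocycle r^v (BruggemanLewisZagier2015 eq. (6), s = 1/2,
line-model action
(φ|g)(t) = |ct+d|⁻¹ φ(gt), which is piecewise RATIONAL exactly because 2s ∈ ℤ) is cohomologous,
modulo coboundaries of
semi-analytic vectors V^{ω*}_{1/2}, to a cocycle with values in PR_ℚ = piecewise-rational functions
with rational
breakpoints and rational coefficients (RationalPeriodClassesQuarter); together with (i) BLZ Theorem
B at the unitary
point s = 1/2 in the form "r^u is not a V^{ω*}-coboundary unless u = 0"
(PeriodClassNontrivialQuarter), (ii) rigidity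
H¹(Γ₁(N); PR_ℂ) ↪ H¹(Γ₁(N); V^{ω*}_{1/2}) (SemiAnalyticRigidity) and (iii) stability of the ℚ-form
under p^{-1/2}T_p
(HeckePreservesRationalPeriods). X ⟹ HeckeFieldQuarter: the unitarily normalised Hecke eigenvalues
a_p (p ∤ N) of
every Maass–Hecke eigenform of eigenvalue 1/4, any level N and nebentypus χ, lie in ONE number field
(by the
descending-chain lemma RationalEigencharacterLemma, no finite-dimensionality of S(N) or of
H¹(Γ;PR_ℚ) is needed) —
the statement Scholze2015 §1 singles out as open in the basic non-regular case
(Literature.Barriers.Langlands.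
NonRegularWeightBarrier, maassQuarterInfinityType). The remaining distance to `Langlands` is carried
by two explicit
hand-off items: ArtinMatchingFromHeckeField (= card kronecker-rigidity-artin-type: algebraicity ⟹
even Artin ρ_π;
not this route's bet) and QuarterSectorToSummit (the unclaimed complement of the sector).

X as a one-line Lean Prop (decls of this route file; all helper notions are inlined by `let` in each
decl, every
constant exists in Mathlib / Literature: Matrix.SpecialLinearGroup,
CongruenceSubgroup.Gamma1/Gamma0, UpperHalfPlane.I /
.ofComplex, DirichletCharacter, Literature.NumberTheory.Automorphic.IsC2 / hypLaplacian, fderiv,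
intervalIntegral,
AnalyticOnNhd, Polynomial.aeval, TensorProduct, LinearMap.baseChange, IntermediateField,
FramedArtinRep, GaloisRep.frobTrace):
  RationalPeriodClassesQuarter ∧ PeriodClassNontrivialQuarter ∧ SemiAnalyticRigidity ∧
HeckePreservesRationalPeriods → HeckeFieldQuarter
Assembly (filed): RationalPeriodClassesQuarter → PeriodClassNontrivialQuarter → SemiAnalyticRigidity
→ HeckePreservesRationalPeriods →
RationalEigencharacterLemma → ArtinMatchingFromHeckeField → QuarterSectorToSummit → Langlands.

Rationale: WHY THIS LINE. Algebraicity of Hecke eigenvalues always comes from a ℚ-structure on a cohomology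
group realising the forms; at λ = 1/4 no
finite-dimensional algebraic local system exists (NonRegularWeightBarrier: parameter (0,0) is
singular), but Γ-cohomology with INFINITE-
dimensional principal-series coefficients does realise Maass cusp forms for all 0 < Re s < 1, s =
1/2 included (BruggemanLewisZagier2015
Thm B, read p. 6; Thm C/'exc' excludes s = 1/2; LewisZagier2001; DeitmarHilgert2007 for finite-index
subgroups). The accident used: the
cocycle factor |ct+d|^{-2s} is (piecewise) rational iff 2s ∈ ℤ, so exactly at s = 1/2 (λ = 1/4, the
archimedean type of EVEN Artin
representations) the piecewise-rational functions PR_ℚ form a Hecke-stable ℚ[GL₂(ℚ)⁺]-submodule of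
V^{ω*}_{1/2} (det-free action). Import:
Eichler–Shimura/Manin rationality and Knopp–Choie–Zagier rational period functions (ChoieZagier1993,
integer weight) transplanted to the
unitary principal series; quantum modular forms (Zagier 2010 Example 1: Cohen's λ = 1/4 form on
Γ₀(2), values in ℚ(ζ₂₄); BLZ §14.4;
Bruggeman 2007) are the nearest observed rationality phenomenon at s = 1/2, for DIHEDRAL forms only.
WHAT THE ROUTE ADDS TO THE CARD (correctness flags of the novelty audit answered): (a) the √p:
r^{u∘M} picks up (det M)^{1/2}, so the
rational operators are p^{-1/2}T_p and the number field contains the unitarily normalised a_p = tr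
ρ(Frob_p), not √p·a_p; (b) no
finiteness of H¹(Γ;PR_ℚ) is needed: RationalEigencharacterLemma (descending chain U ⊇ U∩⋂T_i⁻¹U ⊇ …)
turns ONE eigenvector in V_ℚ⊗ℂ into a
finite-dimensional Hecke-stable ℚ-space; (c) the ℚ-form needs injectivity S_ℚ⊗ℂ → S, isolated as
SemiAnalyticRigidity + BLZ non-triviality.
RANKED CRUXES. #2 RationalPeriodClassesQuarter (the bet; likely false-or-deep; cheapest tests:
dihedral λ = 1/4 forms, weight-one control
with the signed action on Γ₁(23)). #3 PeriodClassNontrivialQuarter (BLZ Thm B at s = 1/2 for the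
explicit segment integral; known in
substance, s = 1/2 resonant). #4 SemiAnalyticRigidity (new elementary statement; difference
equations). #5 HeckePreservesRationalPeriods
(standard double-coset bookkeeping, Muhlenbruch2006 / Hilgert–Mayer–Movasati / Lee arXiv:1804.10773;
my normalisations are the risk).
#6 NoRationalPeriodClass (negative side, staffed: 'Maass 1/4 forms are cohomologically irrational'
would itself be a theorem).
Support: RationalEigencharacterLemma (provable now), PeriodCocycleIdentity (sanity of the typed
cocycle), ArtinMatchingFromHeckeField
(hand-off = kronecker card), QuarterSectorToSummit (unclaimed complement), Assembly (proof plan in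
its docstring).
KILL CRITERIA. (1) A proof of NoRationalPeriodClass, or any invariant of H¹(Γ₁(N);V^{ω*}_{1/2}) that
is ℚ-valued on PR_ℚ classes and
provably irrational on one cusp-form class ⇒ close refuted:RationalPeriodClassesQuarter. (2)
Refutation of SemiAnalyticRigidity by an
explicit semi-analytic f ⇒ restate with H¹-level injectivity (route survives once). (3) Refutation
of #3 or of PeriodCocycleIdentity ⇒
planner convention error: restate, not close. (4) Weight-one control: if the signed (cx+d)⁻¹
analogue fails for the weight-1 form of
level 23 (kit experiment), downgrade #2 to suspect-false.
NOT DECOMPOSED YET. Parabolic refinement H¹_par(Γ;PR_ℚ); Galois-stability of λ = 1/4 eigensystems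
(same ℚ-form; file when kronecker's (H2)
is routed); GL₂ over number fields (|N(ct+d)|⁻¹); transfer operators (Mayer/Pohl: L_s has a POLE at
s = 1/2); definition items for the helpers.
NOVELTY (full search log in the route's Novelty field). Nearest prior art: BLZ doi:10.1090/memo/1118
(the cohomology; no ℚ-structure
proposed) × ChoieZagier1993/Knopp (rationality in INTEGER weight) × Zagier QMF Example 1 /
arXiv:1311.3043 / arXiv:1804.10773 (rationality
phenomena at s = 1/2 on ℚ for dihedral forms; no Hecke-stable module, no algebraicity consequence);
Muhlenbruch2006 (Hecke on period
functions). Delta: the module PR_ℚ ⊂ V^{ω*}_{1/2}, the ℚ-form conjecture with its √p-normalisation,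
rigidity + descending-chain lemma ⇒
NUMBER-FIELD finiteness with no finite-dimensionality input; typed. Card graded new-combination
(refuter audit 2026-08-15).
BARRIERS. technique_class: period-functions rational-cocycle-module maass-quarter.
NonRegularWeightBarrier — met head-on and evaded by the
coefficient system: infinite-dimensional ℚ[Γ]-module realising the singular principal series itself
(BLZ), no p-adic interpolation, no
eigenvariety, no Betti cohomology with algebraic coefficients. ShimuraVarietyRealizationBarrier —
not engaged (only Γ₁(N) and its cusps).
SolvableImageBarrier — downstream only (ArtinMatchingFromHeckeField; icosahedral residue not evaded,
handed on). TwistedEndoscopySelfDual,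
TaylorWilesNumericalCoincidence, ResiduallyReducibleBarrier, PatchingLocalComponentBarrier,
ModPLanglandsGL2BeyondQp, ShtukaConstantField —
not engaged. Negatives index: empty (2026-08-15).

Novelty: Nearest prior art (searched 2026-08-15 with lit search --source zbmath, lit galaxy search --star
all/pdf, lit read of BruggemanLewisZagier2015 pp. 5-7,16,51,55-56,82-83,92-93 and of Zagier 'Quantum
modular forms' paper:galaxy-pdf-4590193843102524780 pp. 5-6, 26-28; lit frontier/bridges Langlands):
BruggemanLewisZagier2015 doi:10.1090/memo/1118 (Maass cusp forms = parabolic cohomology with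
semi-analytic principal-series coefficients for 0<Re s<1, s=1/2 included by Thm B; no rational
structure proposed), LewisZagier2001 doi:10.2307/2661374, DeitmarHilgert2007
doi:10.1515/forum.2007.042 (finite-index subgroups), ChoieZagier1993 doi:10.1090/conm/143/00992 and
Knopp doi:10.1007/bfb0083573 (rational period functions, INTEGER weight), Muhlenbruch2006
doi:10.1016/j.jnt.2005.09.003 + doi:10.1017/s0305004105008480 + doi:10.1515/crelle.2007.014 (Hecke
operators on period functions of Gamma_0(n)), Zagier QMF 2010 Example 1 / Li-Ngo-Rhoades
arXiv:1311.3043 / Lee arXiv:1804.10773 (rationality phenomena at s=1/2 restricted to Q, dihedral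
forms only, no Hecke-stable Q[Gamma]-module, no algebraicity consequence), Sarnak zbl:1035.11023
(integer coefficients => Artin type). Delta: the Hecke-stable module PR_Q of piecewise-rational
functions inside V^{omega*}_{1/2} (available exactly because |ct+d|^{-2s} is rational iff 2s in Z),
the Q-form conjecture RationalPeriodClassesQuarter with its sqrt(p)-normalisation (rational
operators p^{-1/2}T_p), and the mechanism rigidity + BLZ non-triviality + de  [refs: 10.1090/memo/1118, 10.2307/2661374, 10.1515/forum.2007.042, 10.1090/conm/143/00992, 10.1007/bfb0083573, 10.1016/j.jnt.2005.09.003, 10.1017/s0305004105008480, 10.1515/crelle.2007.014, 1311.3043, 1804.10773, paper:galaxy-pdf-4590193843102524780, doi:10.1090/memo/1118, doi:10.2307/2661374, doi:10.1515/forum.2007.042, doi:10.1090/conm/143/00992, doi:10.1007/bfb0083573, doi:10.1016/j.jnt.2005.09.003, d]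

Barriers (technique_class: period-functions rational-cocycle-module maass-quarter): technique_class: period-functions rational-cocycle-module maass-quarter
- Literature.Barriers.Langlands.NonRegularWeightBarrier: met head-on and evaded by changing the
coefficient system - the barrier's kernel (proved there) is that cohomology with finite-dimensional
ALGEBRAIC coefficients V_lambda carries only regular infinity types, so maassQuarterInfinityType is
invisible to Betti/p-adic methods; this route uses Eichler's H^1 of Gamma_1(N) with the
INFINITE-dimensional module of semi-analytic vectors of the singular principal series itself
(BruggemanLewisZagier2015 Thm B realises the lambda=1/4 cusp forms there) and bets on a Hecke-stable
Q-submodule PR_Q available only at 2s in Z; no p-adic interpolation, eigenvariety, completed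
cohomology or patching.
- Literature.Barriers.Langlands.ShimuraVarietyRealizationBarrier: not engaged - nothing is realised
in the cohomology of a Shimura variety; only the arithmetic group Gamma_1(N) < SL_2(Z), its cusps
P^1(Q) and functions on P^1(R) enter.
- Literature.Barriers.Langlands.SolvableImageBarrier: not evaded and not met by the cruxes - it
bites only downstream, inside the hand-off item ArtinMatchingFromHeckeField (algebraicity => Artin
rho needs a non-cyclic step for icosahedral type); declared scope boundary, shared with card
kronecker-rigidity-artin-type.
- Literature.Barriers.Langlands.TwistedEndoscopySelfDual: not engaged (no trace formula comparison,
no self-duality hypothesis; GL_2 over Q only).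

Novelty grade: new-combination — ROUTE REVIEW gen-2 (refuter, 3rd pass ~14:45Z; gen-0/gen-1 briefings stand). 11/11 rc0 (W1.lean); Assembly plumbing compiles. NEW since gen-1: library support landed 12:40–14:16Z — BLZPeriodCocycle.lean (lineSlash, IsSemiAnalyticVector = route's IsSemiAnalytic, BLZ (2.25) PROVED `hypPoissonKernelCpo (refuter refuter-rreview-route-Langlands-Rational-1dd750bb-g2-0, 2026-08-15T14:33:21Z; prior: doi:10.1090/memo/1118, doi:10.2307/2661374, doi:10.1090/conm/143/00992, doi:10.1007/bfb0083573, doi:10.1016/j.jnt.2005.09.003, arXiv:1804.10773, arXiv:1311.3043)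

History (route lifecycle, newest last):
- 2026-08-22T12:01:58Z · DORMANT — reconciler: no traction for 5.3 d (last activity item-evidence-added at 2026-08-17T03:51:33Z); parked, not closed — `ledger route dormant route-Langlands-Ration (operator:999:96154)
- 2026-08-31T16:44:31Z · REACTIVATED (open) — reconciler: reactivated — activity statement-closed at 2026-08-31T15:49:07Z after parking at 2026-08-22T12:01:58Z (operator:999:2529138)

sub-problem: Langlands · status: open · opened planner-plancard-Langlands-Langlands-rational-d9400559-0 2026-08-15T11:08:42Z · rev 2 · ledger route-Langlands-RationalPeriodQuarter
GENERATED by the gate from the ledger (D-0016/17). Provers cite these decls: `theorem foo : Summit.Langlands.Langlands.Theses.RationalPeriodQuarter.<Decl> := …` in Summits/Langlands/Langlands/Theorems/<Name>.lean.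
-/

namespace Summit.Langlands.Langlands.Theses.RationalPeriodQuarter

open scoped BigOperators Topology Manifold Classical MeasureTheory ProbabilityTheory Matrix InnerProductSpace ComplexConjugate ContinuousMap
open Filter Set Function TopologicalSpace MeasureTheory

attribute [summit_statement] _root_.Langlands

/-- item stmt-Langlands-2803 · target · rank 0 · open · by planner
why it might fail: Could fail only if non-Artin-type lambda=1/4 cusp forms exist (transcendental eigenvalue systems) - contradicting Langlands (A)+(Fontaine-Mazur: HT weights (0,0) => Artin); no counterexample known (Booker-Strombergsson numerics doi:10.1515/crelle.2007.047).
sources: Scholze2015, arXiv:2109.14145, zbl:1035.11023, doi:10.1515/crelle.2007.047, Literature.Barriers.Langlands.NonRegularWeightBarrier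
[target] HECKE-FIELD FINITENESS AT EIGENVALUE 1/4 (the deliverable of this route; = crux N1 of card
kronecker-rigidity-artin-type for GL2/Q Maass forms). For every level N, even Dirichlet character
chi mod N and every bounded C^2 solution u of Delta u = -u/4 on Gamma_0(N) with nebentypus chi
(bounded <=> cuspidal at this eigenvalue: constant terms a*sqrt(y)+b*sqrt(y)log y must vanish), u !=
0, which is an eigenfunction of the classical T_p = sum_b u((z+b)/p) + chi(p) u(pz) (p prime, p not
dividing N) with T_p u = sqrt(p) a_p u (a_p = unitarily normalised eigenvalue, = tr rho(Frob_p) for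
Artin type), the a_p lie in ONE number field E. Open (Scholze2015 sec.1: 'not even known that the
eigenvalues of the Hecke operators are algebraic'; Calegari arXiv:2109.14145 sec.12). NOTE the
normalisation: sqrt(p)*a_p do NOT lie in a common number field even for dihedral forms. -/
@[route_item "route-Langlands-RationalPeriodQuarter"]
def HeckeFieldQuarter : Prop :=
  ∀ N : ℕ, 0 < N → ∀ (χ : DirichletCharacter ℂ N) (u : UpperHalfPlane → ℂ), Literature.NumberTheory.Automorphic.IsC2 u → (∀ γ ∈ CongruenceSubgroup.Gamma0 N, ∀ z : UpperHalfPlane, u (γ • z) = χ ((((γ : Matrix (Fin 2) (Fin 2) ℤ) 1 1 : ℤ) : ZMod N)) * u z) → (∀ z : UpperHalfPlane, Literature.NumberTheory.Automorphic.hypLaplacian u z + (1 / 4 : ℂ) * u z = 0) → (∃ C : ℝ, ∀ z : UpperHalfPlane, ‖u z‖ ≤ C) → (∃ z, u z ≠ 0) → ∀ a : ℕ → ℂ, (∀ p : ℕ, p.Prime → ¬ p ∣ N → ∀ z : UpperHalfPlane, ∑ b ∈ Finset.range p, u (UpperHalfPlane.ofComplex (((z : ℂ) + b) / p)) + χ (p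 : ZMod N) * u (UpperHalfPlane.ofComplex ((p : ℂ) * (z : ℂ))) = ((Real.sqrt p : ℝ) : ℂ) * a p * u z) → ∃ E : IntermediateField ℚ ℂ, FiniteDimensional ℚ E ∧ ∀ p : ℕ, p.Prime → ¬ p ∣ N → a p ∈ E

/-- item stmt-Langlands-2804 · crux · rank 2 · open · by planner
why it might fail: Period classes of cusp forms have ANALYTIC values; being cohomologous in V^{omega*} to a kinked/polar piecewise-rational cocycle may simply be false (transcendental periods: Taylor coeffs of psi_u are L-values, LZ doi:10.2307/2661374 Ch.II); dihedral/weight-1 test is the cheap falsifier.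
sources: doi:10.1090/memo/1118, doi:10.2307/2661374, doi:10.1090/conm/143/00992, paper:galaxy-pdf-4590193843102524780, arXiv:1311.3043, doi:10.1515/forum.2007.042
[crux] RPF_{1/4} (Eichler-Shimura at eigenvalue 1/4, spanning form; THE BET of card
rational-period-functions-quarter). S := Maass cusp forms of eigenvalue 1/4 on Gamma_1(N)
(IsQuarterCuspForm: C^2, Gamma_1(N)-invariant, Delta u = -u/4, bounded). r^u_gamma(t) :=
int_{gamma^{-1} i}^{i} [u, R(t;.)^{1/2}] ([u,v] = u_z v dz + u v_zbar dzbar, R(t;z)^{1/2} = sqrt(Im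
z)/|z-t|; BLZ eq.(6)) is the analytic cocycle of u for the s=1/2 action (phi|g)(t) = |ct+d|^{-1}
phi(gt) (|ct+d|^{-2s} is piecewise RATIONAL iff 2s in Z). S_Q := {v in S : r^v = q + (f|gamma - f)
off finite sets, q a Gamma_1(N)-cocycle with values in PR_Q (piecewise rational, rational
breakpoints, Q-coefficients), f semi-analytic (V^{omega*}_{1/2}: real-analytic off a finite set)}
(HasRationalPeriodClass). CLAIM: S is spanned over C by S_Q. With the other cruxes this makes S_Q a
Hecke-stable Q-FORM of S (p^{-1/2}T_p rational on it) => target. Parabolicity of q is expected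
(H^1_par(Gamma;PR_Q)) but deliberately not required. First tests: dihedral 1/4-forms (Cohen's form,
Zagier QMF Ex.1) and the weight-one control (signed action, Gamma_1(23)). -/
@[route_item "route-Langlands-RationalPeriodQuarter", crux]
def RationalPeriodClassesQuarter : Prop :=
  let slashHalf : Matrix.SpecialLinearGroup (Fin 2) ℤ → (ℝ → ℂ) → ℝ → ℂ := fun g φ t => ((|((g : Matrix (Fin 2) (Fin 2) ℤ) 1 0 : ℝ) * t + ((g : Matrix (Fin 2) (Fin 2) ℤ) 1 1 : ℝ)|⁻¹ : ℝ) : ℂ) * φ ((((g : Matrix (Fin 2) (Fin 2) ℤ) 0 0 : ℝ) * t + ((g : Matrix (Fin 2) (Fin 2) ℤ) 0 1 : ℝ)) / (((g : Matrix (Fin 2) (Fin 2) ℤ) 1 0 : ℝ) * t + ((g : Matrix (Fin 2) (Fin 2) ℤ) 1 1 : ℝ))); let IsQuarterCuspForm : ℕ → (UpperHalfPlane → ℂ) → Prop := fun N u => Literature.NumberTheory.Automorphic.IsC2 u ∧ (∀ γ ∈ CongruenceSubgroup.Gamma1 N, ∀ z : UpperHalfPlane, u (γ • z) = u z) ∧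 (∀ z : UpperHalfPlane, Literature.NumberTheory.Automorphic.hypLaplacian u z + (1 / 4 : ℂ) * u z = 0) ∧ ∃ C : ℝ, ∀ z : UpperHalfPlane, ‖u z‖ ≤ C; let lzCocycle : (UpperHalfPlane → ℂ) → Matrix.SpecialLinearGroup (Fin 2) ℤ → ℝ → ℂ := fun u γ t => ∫ τ in (0 : ℝ)..1, (let w : ℂ := (1 - (τ : ℂ)) * ((γ⁻¹ • UpperHalfPlane.I : UpperHalfPlane) : ℂ) + (τ : ℂ) * Complex.I; let dw : ℂ := Complex.I - ((γ⁻¹ • UpperHalfPlane.I : UpperHalfPlane) : ℂ); (fderiv ℝ (u ∘ UpperHalfPlane.ofComplex) w 1 - Complex.I * fderiv ℝ (u ∘ UpperHalfPlane.ofComplex) w Complex.I) / 2 * ((Real.sqrt w.im / ‖w - (t : ℂ)‖ : ℝ) : ℂ) * dw + (u ∘ UpperHalfPlane.ofComplex) w * (((fderiv ℝ (fun x : ℂ => Real.sqrt x.im / ‖x - (t : ℂ)‖) w 1 : ℝ) + Complex.I * (fderiv ℝ (fun x : ℂ => Real.sqrt x.im / ‖x - (t : ℂ)‖) w Complex.I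 : ℝ)) / 2) * (starRingEnd ℂ) dw); let IsPRQ : (ℝ → ℂ) → Prop := fun φ => ∃ F : Finset ℚ, (∀ a b : ℚ, a < b → (∀ r ∈ F, r ≤ a ∨ b ≤ r) → ∃ P Q : Polynomial ℚ, ∀ x : ℝ, (a : ℝ) < x → x < b → Polynomial.aeval (x : ℂ) Q ≠ 0 ∧ φ x = Polynomial.aeval (x : ℂ) P / Polynomial.aeval (x : ℂ) Q) ∧ ∃ B : ℚ, (∃ P Q : Polynomial ℚ, ∀ x : ℝ, (B : ℝ) < x → Polynomial.aeval (x : ℂ) Q ≠ 0 ∧ φ x = Polynomial.aeval (x : ℂ) P / Polynomial.aeval (x : ℂ) Q) ∧ (∃ P Q : Polynomial ℚ, ∀ x : ℝ, x < -(B : ℝ) → Polynomial.aeval (x : ℂ) Q ≠ 0 ∧ φ x = Polynomial.aeval (x : ℂ) P / Polynomial.aeval (x : ℂ) Q); let IsSemiAnalytic : (ℝ → ℂ) → Prop := fun f => ∃ F : Finset ℝ, AnalyticOnNhd ℝ f ((↑F : Set ℝ)ᶜ); let HasRationalPeriodClass : ℕ → (UpperHalfPlane → ℂ) → Prop := fun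 N u => ∃ (q : Matrix.SpecialLinearGroup (Fin 2) ℤ → ℝ → ℂ) (f : ℝ → ℂ), (∀ γ ∈ CongruenceSubgroup.Gamma1 N, IsPRQ (q γ)) ∧ (∀ γ ∈ CongruenceSubgroup.Gamma1 N, ∀ δ ∈ CongruenceSubgroup.Gamma1 N, ∀ᶠ t in Filter.cofinite, q (γ * δ) t = slashHalf δ (q γ) t + q δ t) ∧ IsSemiAnalytic f ∧ ∀ γ ∈ CongruenceSubgroup.Gamma1 N, ∀ᶠ t in Filter.cofinite, lzCocycle u γ t = q γ t + slashHalf γ f t - f t; ∀ N : ℕ, 0 < N → ∀ u : UpperHalfPlane → ℂ, IsQuarterCuspForm N u → ∃ (m : ℕ) (v : Fin m → UpperHalfPlane → ℂ) (c : Fin m → ℂ), (∀ i, IsQuarterCuspForm N (v i) ∧ HasRationalPeriodClass N (v i)) ∧ ∀ z, u z = ∑ i, c i * v i z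

/-- item stmt-Langlands-2805 · crux · rank 3 · closed · proved by Summit.Langlands.Langlands.Theorems.periodClassNontrivialQuarter (planner) · by planner
why it might fail: s=1/2 is the resonant point (y^{1/2} log y, Thm C excludes s=1/2, Prop 9.18 needs s != 1/2); an error in my explicit conventions (orientation only flips sign; a wrong Green form breaks closedness) would make the typed cocycle the wrong object.
sources: doi:10.1090/memo/1118, doi:10.2307/2661374, doi:10.1515/forum.2007.042
[crux] BLZ THEOREM B AT THE UNITARY POINT s = 1/2, in the form the route needs: a nonzero Maass cusp
form of eigenvalue 1/4 on Gamma_1(N) has a period cocycle r^u that is NOT a coboundary of a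
semi-analytic vector (injectivity of Maass^0_{1/2}(Gamma_1(N)) -> H^1(Gamma_1(N);
V^{omega*}_{1/2})). In substance known: BLZ doi:10.1090/memo/1118 Thm B (p.6: 0<Re s<1, s=1/2
INCLUDED; Maass^0_s = H^1_par(Gamma;V^omega,V^{omega*,infty})) plus the exact sequence
(13.2)/S^Gamma = 0 (p.83: H^1_par(Gamma;V^omega,W) -> H^1_par(Gamma;W) injective for V^omega < W <
V^{omega*}). To be re-proved for the explicit segment integral used here (base point i; [u,v] = u_z
v dz + u v_zbar dzbar; line model); Deitmar-Hilgert doi:10.1515/forum.2007.042 for finite-index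
subgroups. Needed so that S_Q (x) C -> S is injective (Q-independent rational-period forms stay
C-independent). -/
@[route_item "route-Langlands-RationalPeriodQuarter", crux]
def PeriodClassNontrivialQuarter : Prop :=
  let slashHalf : Matrix.SpecialLinearGroup (Fin 2) ℤ → (ℝ → ℂ) → ℝ → ℂ := fun g φ t => ((|((g : Matrix (Fin 2) (Fin 2) ℤ) 1 0 : ℝ) * t + ((g : Matrix (Fin 2) (Fin 2) ℤ) 1 1 : ℝ)|⁻¹ : ℝ) : ℂ) * φ ((((g : Matrix (Fin 2) (Fin 2) ℤ) 0 0 : ℝ) * t + ((g : Matrix (Fin 2) (Fin 2) ℤ) 0 1 : ℝ)) / (((g : Matrix (Fin 2) (Fin 2) ℤ) 1 0 : ℝ) * t + ((g : Matrix (Fin 2) (Fin 2) ℤ) 1 1 : ℝ))); let IsQuarterCuspForm : ℕ → (UpperHalfPlane → ℂ) → Prop := fun N u => Literature.NumberTheory.Automorphic.IsC2 u ∧ (∀ γ ∈ CongruenceSubgroup.Gamma1 N, ∀ z : UpperHalfPlane, u (γ • z) = u z) ∧ (∀ z : UpperHalfPlane, Literature.NumberTheory.Automorphic.hypLaplacian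 u z + (1 / 4 : ℂ) * u z = 0) ∧ ∃ C : ℝ, ∀ z : UpperHalfPlane, ‖u z‖ ≤ C; let lzCocycle : (UpperHalfPlane → ℂ) → Matrix.SpecialLinearGroup (Fin 2) ℤ → ℝ → ℂ := fun u γ t => ∫ τ in (0 : ℝ)..1, (let w : ℂ := (1 - (τ : ℂ)) * ((γ⁻¹ • UpperHalfPlane.I : UpperHalfPlane) : ℂ) + (τ : ℂ) * Complex.I; let dw : ℂ := Complex.I - ((γ⁻¹ • UpperHalfPlane.I : UpperHalfPlane) : ℂ); (fderiv ℝ (u ∘ UpperHalfPlane.ofComplex) w 1 - Complex.I * fderiv ℝ (u ∘ UpperHalfPlane.ofComplex) w Complex.I) / 2 * ((Real.sqrt w.im / ‖w - (t : ℂ)‖ : ℝ) : ℂ) * dw + (u ∘ UpperHalfPlane.ofComplex) w * (((fderiv ℝ (fun x : ℂ => Real.sqrt x.im / ‖x - (t : ℂ)‖) w 1 : ℝ) + Complex.I * (fderiv ℝ (fun x : ℂ => Real.sqrt x.im / ‖x - (t : ℂ)‖) w Complex.I : ℝ)) / 2) * (starRingEnd ℂ) dw); let IsSemiAnalytic : (ℝ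 → ℂ) → Prop := fun f => ∃ F : Finset ℝ, AnalyticOnNhd ℝ f ((↑F : Set ℝ)ᶜ); ∀ N : ℕ, 0 < N → ∀ u : UpperHalfPlane → ℂ, IsQuarterCuspForm N u → (∃ f : ℝ → ℂ, IsSemiAnalytic f ∧ ∀ γ ∈ CongruenceSubgroup.Gamma1 N, ∀ᶠ t in Filter.cofinite, lzCocycle u γ t = slashHalf γ f t - f t) → ∀ z, u z = 0

-- `PeriodClassNontrivialQuarter` holds: proved by `Summit.Langlands.Langlands.Theorems.periodClassNontrivialQuarter` (its module imports this route file, so no `_holds` link can be stated here).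

/-- item stmt-Langlands-2806 · crux · rank 4 · closed · proved by Summit.Langlands.Langlands.Theorems.rationalPeriodQuarter_semiAnalyticRigidity (planner) · by planner
why it might fail: A Gamma_1(N)-invariant (or invariant-mod-PR) semi-analytic vector at s=1/2 would break it: e.g. boundary values of d/ds E(z,s)|_{1/2} or of E(z,1/2) if they were analytic off finitely many points (I believe their singular support is all of Q, BLZ sec.13.1).
sources: doi:10.1090/memo/1118, doi:10.1007/bfb0083573
[crux] RIGIDITY / INJECTIVITY H^1(Gamma_1(N); PR_C) -> H^1(Gamma_1(N); V^{omega*}_{1/2}): a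
semi-analytic f (real-analytic off a finite set) all of whose coboundary values f|gamma - f (gamma
in Gamma_1(N), s=1/2 action) are piecewise rational with rational breakpoints, complex numerators
and RATIONAL denominators (PR_C = PR_Q (x)_Q C; note 1/(x-sqrt2) = (x+sqrt2)/(x^2-2) is excluded
only by the no-interior-real-pole clause) is itself PR_C off a finite set. Heuristic proof:
f(t+1)-f(t) rational forces f = PR + 1-periodic analytic p, and the unipotent [[1,0],[N,1]] (t ->
t/(Nt+1)) forces p constant (rational functions do not oscillate at 0+). Gives: the kernel of
H^1(PR_Q) (x) C -> H^1(V^{omega*}) is trivial, so S_Q is a genuine Q-structure (with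
PeriodClassNontrivialQuarter). New statement (no source states it); elementary real analysis +
difference equations. -/
@[route_item "route-Langlands-RationalPeriodQuarter", crux]
def SemiAnalyticRigidity : Prop :=
  let slashHalf : Matrix.SpecialLinearGroup (Fin 2) ℤ → (ℝ → ℂ) → ℝ → ℂ := fun g φ t => ((|((g : Matrix (Fin 2) (Fin 2) ℤ) 1 0 : ℝ) * t + ((g : Matrix (Fin 2) (Fin 2) ℤ) 1 1 : ℝ)|⁻¹ : ℝ) : ℂ) * φ ((((g : Matrix (Fin 2) (Fin 2) ℤ) 0 0 : ℝ) * t + ((g : Matrix (Fin 2) (Fin 2) ℤ) 0 1 : ℝ)) / (((g : Matrix (Fin 2) (Fin 2) ℤ) 1 0 : ℝ) * t + ((g : Matrix (Fin 2) (Fin 2) ℤ) 1 1 : ℝ))); let IsPRC : (ℝ → ℂ) → Prop := fun φ => ∃ F : Finset ℚ, (∀ a b : ℚ, a < b → (∀ r ∈ F, r ≤ a ∨ b ≤ r) → ∃ (P : Polynomial ℂ) (Q : Polynomial ℚ), ∀ x : ℝ, (a : ℝ) < x → x < b → Polynomial.aeval (x : ℂ) Q ≠ 0 ∧ φ x = Polynomial.eval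 (x : ℂ) P / Polynomial.aeval (x : ℂ) Q) ∧ ∃ B : ℚ, (∃ (P : Polynomial ℂ) (Q : Polynomial ℚ), ∀ x : ℝ, (B : ℝ) < x → Polynomial.aeval (x : ℂ) Q ≠ 0 ∧ φ x = Polynomial.eval (x : ℂ) P / Polynomial.aeval (x : ℂ) Q) ∧ (∃ (P : Polynomial ℂ) (Q : Polynomial ℚ), ∀ x : ℝ, x < -(B : ℝ) → Polynomial.aeval (x : ℂ) Q ≠ 0 ∧ φ x = Polynomial.eval (x : ℂ) P / Polynomial.aeval (x : ℂ) Q); let IsSemiAnalytic : (ℝ → ℂ) → Prop := fun f => ∃ F : Finset ℝ, AnalyticOnNhd ℝ f ((↑F : Set ℝ)ᶜ); ∀ N : ℕ, 0 < N → ∀ f : ℝ → ℂ, IsSemiAnalytic f → (∀ γ ∈ CongruenceSubgroup.Gamma1 N, ∃ q : ℝ → ℂ, IsPRC q ∧ ∀ᶠ t in Filter.cofinite, slashHalf γ f t - f t = q t) → ∃ q : ℝ → ℂ, IsPRC q ∧ ∀ᶠ t in Filter.cofinite, f t = q t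

-- `SemiAnalyticRigidity` holds: proved by `Summit.Langlands.Langlands.Theorems.rationalPeriodQuarter_semiAnalyticRigidity` (its module imports this route file, so no `_holds` link can be stated here).

/-- item stmt-Langlands-2807 · crux · rank 5 · open · by planner
why it might fail: The coboundary term f must transform too (T on 0-cochains = sum f|M_i keeps semi-analyticity: fine); risk is in MY normalisations: det-free boundary action vs sqrt(det) from R^{1/2}, and the sigma_p twist at level Gamma_1(N); a slip flips p^{-1/2} to p^{+1/2}.
sources: doi:10.1016/j.jnt.2005.09.003, doi:10.1017/s0305004105008480, doi:10.1515/crelle.2007.014, arXiv:1804.10773, doi:10.1090/memo/1118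
[crux] HECKE STABILITY OF THE Q-STRUCTURE: for p prime not dividing N and any sigma in Gamma_0(N)
with lower-right entry = p mod N, the Gamma_1(N) Hecke operator T_p u(z) = sum_{b<p} u((z+b)/p) +
u(sigma(pz)) (Diamond-Shurman Prop 5.2.1; independent of sigma by Gamma_1(N)-invariance) maps S to
S, and p^{-1/2} T_p maps S_Q to S_Q. Mechanism: r^{u o M} = (det M)^{1/2} |c_M t + d_M|^{-1}
(pullback of r^u by M) + base-point coboundaries (from R(t;z)^{1/2} = (det M)^{1/2}|ct+d|^{-1}
R(Mt;Mz)^{1/2}, BLZ (2.25)), and PR_Q is stable under the det-FREE action of integer matrices of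
determinant p; hence the sqrt(p): the RATIONAL operators are p^{-1/2}T_p, whose eigenvalues are the
unitarily normalised a_p = tr rho(Frob_p). Hecke operators on period functions of Gamma_0(n):
Muhlenbruch doi:10.1016/j.jnt.2005.09.003, Hilgert-Mayer-Movasati doi:10.1017/s0305004105008480,
Fraczek-Mayer-Muhlenbruch doi:10.1515/crelle.2007.014; Lee arXiv:1804.10773 (Hecke on QMFs of
lambda=1/4 forms). -/
@[route_item "route-Langlands-RationalPeriodQuarter", crux]
def HeckePreservesRationalPeriods : Prop :=
  let slashHalf : Matrix.SpecialLinearGroup (Fin 2) ℤ → (ℝ → ℂ) → ℝ → ℂ := fun g φ t => ((|((g : Matrix (Fin 2) (Fin 2) ℤ) 1 0 : ℝ) * t + ((g : Matrix (Fin 2) (Fin 2) ℤ) 1 1 : ℝ)|⁻¹ : ℝ) : ℂ) * φ ((((g : Matrix (Fin 2) (Fin 2) ℤ) 0 0 : ℝ) * t + ((g : Matrix (Fin 2) (Fin 2) ℤ) 0 1 : ℝ)) / (((g : Matrix (Fin 2) (Fin 2) ℤ) 1 0 : ℝ) * t + ((g : Matrix (Fin 2) (Fin 2) ℤ) 1 1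 : ℝ))); let IsQuarterCuspForm : ℕ → (UpperHalfPlane → ℂ) → Prop := fun N u => Literature.NumberTheory.Automorphic.IsC2 u ∧ (∀ γ ∈ CongruenceSubgroup.Gamma1 N, ∀ z : UpperHalfPlane, u (γ • z) = u z) ∧ (∀ z : UpperHalfPlane, Literature.NumberTheory.Automorphic.hypLaplacian u z + (1 / 4 : ℂ) * u z = 0) ∧ ∃ C : ℝ, ∀ z : UpperHalfPlane, ‖u z‖ ≤ C; let lzCocycle : (UpperHalfPlane → ℂ) → Matrix.SpecialLinearGroup (Fin 2) ℤ → ℝ → ℂ := fun u γ t => ∫ τ in (0 : ℝ)..1, (let w : ℂ := (1 - (τ : ℂ)) * ((γ⁻¹ • UpperHalfPlane.I : UpperHalfPlane) : ℂ) + (τ : ℂ) * Complex.I; let dw : ℂ := Complex.I - ((γ⁻¹ • UpperHalfPlane.I : UpperHalfPlane) : ℂ); (fderiv ℝ (u ∘ UpperHalfPlane.ofComplex) w 1 - Complex.I * fderiv ℝ (u ∘ UpperHalfPlane.ofComplex) w Complex.I) / 2 * ((Real.sqrt w.im / ‖w - (t : ℂ)‖ : ℝ) : ℂ) * dw + (u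 ∘ UpperHalfPlane.ofComplex) w * (((fderiv ℝ (fun x : ℂ => Real.sqrt x.im / ‖x - (t : ℂ)‖) w 1 : ℝ) + Complex.I * (fderiv ℝ (fun x : ℂ => Real.sqrt x.im / ‖x - (t : ℂ)‖) w Complex.I : ℝ)) / 2) * (starRingEnd ℂ) dw); let IsPRQ : (ℝ → ℂ) → Prop := fun φ => ∃ F : Finset ℚ, (∀ a b : ℚ, a < b → (∀ r ∈ F, r ≤ a ∨ b ≤ r) → ∃ P Q : Polynomial ℚ, ∀ x : ℝ, (a : ℝ) < x → x < b → Polynomial.aeval (x : ℂ) Q ≠ 0 ∧ φ x = Polynomial.aeval (x : ℂ) P / Polynomial.aeval (x : ℂ) Q) ∧ ∃ B : ℚ, (∃ P Q : Polynomial ℚ, ∀ x : ℝ, (B : ℝ) < x → Polynomial.aeval (x : ℂ) Q ≠ 0 ∧ φ x = Polynomial.aeval (x : ℂ) P / Polynomial.aeval (x : ℂ) Q) ∧ (∃ P Q : Polynomial ℚ, ∀ x : ℝ, x < -(B : ℝ) → Polynomial.aeval (x : ℂ) Q ≠ 0 ∧ φ x = Polynomial.aeval (x : ℂ) P / Polynomial.aeval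 (x : ℂ) Q); let IsSemiAnalytic : (ℝ → ℂ) → Prop := fun f => ∃ F : Finset ℝ, AnalyticOnNhd ℝ f ((↑F : Set ℝ)ᶜ); let HasRationalPeriodClass : ℕ → (UpperHalfPlane → ℂ) → Prop := fun N u => ∃ (q : Matrix.SpecialLinearGroup (Fin 2) ℤ → ℝ → ℂ) (f : ℝ → ℂ), (∀ γ ∈ CongruenceSubgroup.Gamma1 N, IsPRQ (q γ)) ∧ (∀ γ ∈ CongruenceSubgroup.Gamma1 N, ∀ δ ∈ CongruenceSubgroup.Gamma1 N, ∀ᶠ t in Filter.cofinite, q (γ * δ) t = slashHalf δ (q γ) t + q δ t) ∧ IsSemiAnalytic f ∧ ∀ γ ∈ CongruenceSubgroup.Gamma1 N, ∀ᶠ t in Filter.cofinite, lzCocycle u γ t = q γ t + slashHalf γ f t - f t; ∀ N : ℕ, 0 < N → ∀ p : ℕ, p.Prime → ¬ p ∣ N → ∀ σ ∈ CongruenceSubgroup.Gamma0 N, (((σ : Matrix (Fin 2) (Fin 2) ℤ) 1 1 : ℤ) : ZMod N) = (p : ZMod N) → ∀ u : UpperHalfPlane → ℂ, IsQuarterCuspForm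 N u → HasRationalPeriodClass N u → IsQuarterCuspForm N (fun z : UpperHalfPlane => ((Real.sqrt p : ℝ) : ℂ)⁻¹ * (∑ b ∈ Finset.range p, u (UpperHalfPlane.ofComplex (((z : ℂ) + b) / p)) + u (σ • UpperHalfPlane.ofComplex ((p : ℂ) * (z : ℂ))))) ∧ HasRationalPeriodClass N (fun z : UpperHalfPlane => ((Real.sqrt p : ℝ) : ℂ)⁻¹ * (∑ b ∈ Finset.range p, u (UpperHalfPlane.ofComplex (((z : ℂ) + b) / p)) + u (σ • UpperHalfPlane.ofComplex ((p : ℂ) * (z : ℂ)))))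

/-- item stmt-Langlands-2808 · crux · rank 6 · open · by planner
why it might fail: If RPF_{1/4} is true this is false; even if RPF is false, proving non-representability needs an invariant of H^1(Gamma;V^{omega*}_{1/2}) separating analytic from PR classes - none is known to me.
sources: doi:10.1090/memo/1118, doi:10.2307/2661374
[crux] NEGATIVE SIDE ('Maass forms of eigenvalue 1/4 are cohomologically irrational'): some
lambda=1/4 cusp form on some Gamma_1(N) has a period class NOT represented, modulo semi-analytic
coboundaries, by ANY piecewise-rational cocycle with rational breakpoints (complex numerators,
rational denominators). Implies the failure of RationalPeriodClassesQuarter (it is stronger than its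
negation: it kills even the per-form, complex-coefficient version). A proof would be a theorem worth
recording (negative knowledge for every 'rational Eichler-Shimura at s=1/2' idea); natural
candidates for an obstruction: BLZ duality/Petersson pairing Thm 19.1 evaluated on PR classes, or
the local singularity classes H^1(Gamma_xi; S_xi) at cusps (BLZ sec.13.1) - the latter vanish for PR
cocycles (difference equations with rational right side are solvable by digamma/polynomial germs),
so a finer invariant is needed. -/
@[route_item "route-Langlands-RationalPeriodQuarter"]
def NoRationalPeriodClass : Prop :=
  let slashHalf : Matrix.SpecialLinearGroup (Fin 2) ℤ → (ℝ → ℂ) → ℝ → ℂ := fun g φ t => ((|((g : Matrix (Fin 2) (Fin 2) ℤ) 1 0 : ℝ) * t + ((g : Matrix (Fin 2) (Fin 2) ℤ) 1 1 : ℝ)|⁻¹ : ℝ) : ℂ) * φ ((((g : Matrix (Fin 2) (Fin 2) ℤ) 0 0 : ℝ) * t + ((g : Matrix (Fin 2) (Fin 2) ℤ) 0 1 : ℝ)) / (((g : Matrix (Fin 2) (Fin 2) ℤ) 1 0 : ℝ) * t + ((g : Matrix (Fin 2) (Fin 2) ℤ) 1 1 : ℝ))); let IsQuarterCuspForm : ℕ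 → (UpperHalfPlane → ℂ) → Prop := fun N u => Literature.NumberTheory.Automorphic.IsC2 u ∧ (∀ γ ∈ CongruenceSubgroup.Gamma1 N, ∀ z : UpperHalfPlane, u (γ • z) = u z) ∧ (∀ z : UpperHalfPlane, Literature.NumberTheory.Automorphic.hypLaplacian u z + (1 / 4 : ℂ) * u z = 0) ∧ ∃ C : ℝ, ∀ z : UpperHalfPlane, ‖u z‖ ≤ C; let lzCocycle : (UpperHalfPlane → ℂ) → Matrix.SpecialLinearGroup (Fin 2) ℤ → ℝ → ℂ := fun u γ t => ∫ τ in (0 : ℝ)..1, (let w : ℂ := (1 - (τ : ℂ)) * ((γ⁻¹ • UpperHalfPlane.I : UpperHalfPlane) : ℂ) + (τ : ℂ) * Complex.I; let dw : ℂ := Complex.I - ((γ⁻¹ • UpperHalfPlane.I : UpperHalfPlane) : ℂ); (fderiv ℝ (u ∘ UpperHalfPlane.ofComplex) w 1 - Complex.I * fderiv ℝ (u ∘ UpperHalfPlane.ofComplex) w Complex.I) / 2 * ((Real.sqrt w.im / ‖w - (t : ℂ)‖ : ℝ) : ℂ) * dw + (u ∘ UpperHalfPlane.ofComplex) w * (((fderiv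 ℝ (fun x : ℂ => Real.sqrt x.im / ‖x - (t : ℂ)‖) w 1 : ℝ) + Complex.I * (fderiv ℝ (fun x : ℂ => Real.sqrt x.im / ‖x - (t : ℂ)‖) w Complex.I : ℝ)) / 2) * (starRingEnd ℂ) dw); let IsPRC : (ℝ → ℂ) → Prop := fun φ => ∃ F : Finset ℚ, (∀ a b : ℚ, a < b → (∀ r ∈ F, r ≤ a ∨ b ≤ r) → ∃ (P : Polynomial ℂ) (Q : Polynomial ℚ), ∀ x : ℝ, (a : ℝ) < x → x < b → Polynomial.aeval (x : ℂ) Q ≠ 0 ∧ φ x = Polynomial.eval (x : ℂ) P / Polynomial.aeval (x : ℂ) Q) ∧ ∃ B : ℚ, (∃ (P : Polynomial ℂ) (Q : Polynomial ℚ), ∀ x : ℝ, (B : ℝ) < x → Polynomial.aeval (x : ℂ) Q ≠ 0 ∧ φ x = Polynomial.eval (x : ℂ) P / Polynomial.aeval (x : ℂ) Q) ∧ (∃ (P : Polynomial ℂ) (Q : Polynomial ℚ), ∀ x : ℝ, x < -(B : ℝ) → Polynomial.aeval (x : ℂ) Q ≠ 0 ∧ φ x = Polynomial.eval (x : ℂ)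 P / Polynomial.aeval (x : ℂ) Q); let IsSemiAnalytic : (ℝ → ℂ) → Prop := fun f => ∃ F : Finset ℝ, AnalyticOnNhd ℝ f ((↑F : Set ℝ)ᶜ); ∃ N : ℕ, 0 < N ∧ ∃ u : UpperHalfPlane → ℂ, IsQuarterCuspForm N u ∧ ∀ (q : Matrix.SpecialLinearGroup (Fin 2) ℤ → ℝ → ℂ) (f : ℝ → ℂ), (∀ γ ∈ CongruenceSubgroup.Gamma1 N, IsPRC (q γ)) → IsSemiAnalytic f → ¬ ∀ γ ∈ CongruenceSubgroup.Gamma1 N, ∀ᶠ t in Filter.cofinite, lzCocycle u γ t = q γ t + slashHalf γ f t - f t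

/-- item stmt-Langlands-10432 · support · rank 9 · closed · proved by Summit.Langlands.Langlands.Theorems.rationalPeriodQuarter_heckeFieldOfCruxes (planner) · by planner
[support] LAYER-1 GLUE (D-0027 §2.1 glue repair, planner 2026-08-15): RationalPeriodClassesQuarter
-> PeriodClassNontrivialQuarter -> SemiAnalyticRigidity -> HeckePreservesRationalPeriods ->
RationalEigencharacterLemma -> HeckeFieldQuarter (the target BY NAME). Its content is steps (1)-(5)
of the Assembly proof plan (stmt-2813): given (N, chi, u, a) as in HeckeFieldQuarter, u lies in S =
quarter cusp forms on Gamma_1(N) (Gamma_0(N)-nebentypus chi => Gamma_1(N)-invariant) and T_p^chi u =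
T_{p,sigma} u for any sigma in Gamma_0(N) with lower-right entry = p mod N. (1) S_Q := {v in S :
HasRationalPeriodClass N v} is a Q-subspace (r^u is C-linear in u; PR_Q and the semi-analytic
vectors are subspaces). (2) S_Q (x)_Q C -> S is injective: for Q-independent e_l in C with sum e_l
w_l = 0, w_l in S_Q, the cocycle sum e_l q_l = -d(sum e_l f_l) is PR_C-valued, so
SemiAnalyticRigidity gives G := sum e_l f_l in PR_C off a finite set; the coefficient-wise
projection Pi_1 : PR_C = PR_Q (x) C -> PR_Q (pi_1(e_1) = 1, pi_1(e_l) = 0 for l > 1; commutes with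
slashHalf) yields q_1 = -d(Pi_1 G), hence r^{w_1} = d(f_1 - Pi_1 G) and w_1 = 0 by
PeriodClassNontrivialQuarter. (3) RationalPeriodClassesQuarter -/
@[route_item "route-Langlands-RationalPeriodQuarter", crux]
def HeckeFieldOfCruxes : Prop :=
  RationalPeriodClassesQuarter → PeriodClassNontrivialQuarter → SemiAnalyticRigidity → HeckePreservesRationalPeriods → HeckeFieldQuarter

-- `HeckeFieldOfCruxes` holds: proved by `Summit.Langlands.Langlands.Theorems.rationalPeriodQuarter_heckeFieldOfCruxes` (its module imports this route file, so no `_holds` link can be stated here).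

/-- item stmt-Langlands-2809 · support · rank 9 · closed · proved by Summit.Langlands.Langlands.Theorems.RationalPeriodQuarterEigencharacter.rationalEigencharacterLemma (prover) · by planner
sources: folklore
[support] DESCENDING-CHAIN LEMMA (answers the novelty auditor's finiteness flag; pure linear
algebra, provable now): V ANY Q-vector space (possibly infinite-dimensional), T_i any family of
Q-linear endomorphisms (commutativity not needed), w in C (x)_Q V a nonzero simultaneous eigenvector
of the T_i (x) 1 with eigenvalues a_i. Then all a_i lie in one number field. Proof: w in U (x) C for
a finite-dimensional U; U_1 := U cap (cap_i T_i^{-1} U) still has w in U_1 (x) C (base change is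
exact; the infinite intersection is attained at a finite stage); iterate; the chain stabilises at
U_inf != 0, T_i-stable, finite-dimensional; P -> (scalar of P on w) is a Q-algebra map from the
(f.d.) subalgebra of End(U_inf) generated by the T_i to C, its image is a finite-dimensional
Q-subalgebra of C containing every a_i, hence a number field. Used with V = S_Q, T_i = p_i^{-1/2}
T_{p_i}. -/
@[route_item "route-Langlands-RationalPeriodQuarter"]
def RationalEigencharacterLemma : Prop :=
  ∀ (V : Type) [AddCommGroup V] [Module ℚ V] (ι : Type) (T : ι → V →ₗ[ℚ] V) (a : ι → ℂ) (w : TensorProduct ℚ ℂ V), w ≠ 0 → (∀ i, (T i).baseChange ℂ w = a i • w) → ∃ E : IntermediateField ℚ ℂ, FiniteDimensional ℚ E ∧ ∀ i, a i ∈ E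

-- `RationalEigencharacterLemma` holds: proved by `Summit.Langlands.Langlands.Theorems.RationalPeriodQuarterEigencharacter.rationalEigencharacterLemma` (its module imports this route file, so no `_holds` link can be stated here).

/-- item stmt-Langlands-2810 · support · rank 9 · closed · proved by Summit.Langlands.Langlands.Theorems.periodCocycleIdentity (planner) · by planner
sources: doi:10.1090/memo/1118
[support] SANITY/GLUE (known, BLZ doi:10.1090/memo/1118 eq.(6) + (2.25)): the explicit segment
integral r^u is a 1-cocycle for the right action slashHalf: r_{gamma delta} = r_gamma|delta +
r_delta off the finitely many t where |ct+d|^{-1} is junk. Ingredients: closedness of the Green form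
[u, R(t;.)^{1/2}] for two eigenfunctions of the same eigenvalue (path independence in H),
Gamma_1(N)-invariance of u, and R(t; delta^{-1} w)^{1/2} = |c_delta t + d_delta|^{-1} R(delta t;
w)^{1/2}. Not logically needed for the target (only non-triviality is) but it certifies that the
typed lzCocycle is the intended object; a refutation here means the planner mistyped a convention
(restate), not that the line is dead. -/
@[route_item "route-Langlands-RationalPeriodQuarter"]
def PeriodCocycleIdentity : Prop :=
  let slashHalf : Matrix.SpecialLinearGroup (Fin 2) ℤ → (ℝ → ℂ) → ℝ → ℂ := fun g φ t => ((|((g : Matrix (Fin 2) (Fin 2) ℤ) 1 0 : ℝ) * t + ((g : Matrix (Fin 2) (Fin 2) ℤ) 1 1 : ℝ)|⁻¹ : ℝ) : ℂ) * φ ((((g : Matrix (Fin 2) (Fin 2) ℤ) 0 0 : ℝ) * t + ((g : Matrix (Fin 2) (Fin 2) ℤ) 0 1 : ℝ)) / (((g : Matrix (Fin 2) (Fin 2) ℤ) 1 0 : ℝ) * t + ((g : Matrix (Fin 2) (Fin 2) ℤ) 1 1 : ℝ))); let IsQuarterCuspForm : ℕ → (UpperHalfPlane → ℂ) → Prop :=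 fun N u => Literature.NumberTheory.Automorphic.IsC2 u ∧ (∀ γ ∈ CongruenceSubgroup.Gamma1 N, ∀ z : UpperHalfPlane, u (γ • z) = u z) ∧ (∀ z : UpperHalfPlane, Literature.NumberTheory.Automorphic.hypLaplacian u z + (1 / 4 : ℂ) * u z = 0) ∧ ∃ C : ℝ, ∀ z : UpperHalfPlane, ‖u z‖ ≤ C; let lzCocycle : (UpperHalfPlane → ℂ) → Matrix.SpecialLinearGroup (Fin 2) ℤ → ℝ → ℂ := fun u γ t => ∫ τ in (0 : ℝ)..1, (let w : ℂ := (1 - (τ : ℂ)) * ((γ⁻¹ • UpperHalfPlane.I : UpperHalfPlane) : ℂ) + (τ : ℂ) * Complex.I; let dw : ℂ := Complex.I - ((γ⁻¹ • UpperHalfPlane.I : UpperHalfPlane) : ℂ); (fderiv ℝ (u ∘ UpperHalfPlane.ofComplex) w 1 - Complex.I * fderiv ℝ (u ∘ UpperHalfPlane.ofComplex) w Complex.I) / 2 * ((Real.sqrt w.im / ‖w - (t : ℂ)‖ : ℝ) : ℂ) * dw + (u ∘ UpperHalfPlane.ofComplex) w * (((fderiv ℝ (fun x : ℂ => Real.sqrt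 x.im / ‖x - (t : ℂ)‖) w 1 : ℝ) + Complex.I * (fderiv ℝ (fun x : ℂ => Real.sqrt x.im / ‖x - (t : ℂ)‖) w Complex.I : ℝ)) / 2) * (starRingEnd ℂ) dw); ∀ N : ℕ, 0 < N → ∀ u : UpperHalfPlane → ℂ, IsQuarterCuspForm N u → ∀ γ ∈ CongruenceSubgroup.Gamma1 N, ∀ δ ∈ CongruenceSubgroup.Gamma1 N, ∀ᶠ t in Filter.cofinite, lzCocycle u (γ * δ) t = slashHalf δ (lzCocycle u γ) t + lzCocycle u δ t

-- `PeriodCocycleIdentity` holds: proved by `Summit.Langlands.Langlands.Theorems.periodCocycleIdentity` (its module imports this route file, so no `_holds` link can be stated here).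

/-- item stmt-Langlands-2811 · support · rank 9 · open · by planner
sources: zbl:1035.11023, doi:10.1155/s1073792803206097, Literature.Barriers.Langlands.SolvableImageBarrier
[support] DOWNSTREAM HAND-OFF, NOT THIS ROUTE'S BET: Hecke-field finiteness for all lambda=1/4
eigenforms over Q => each corresponds to a 2-dimensional Artin representation rho (a_p = tr
rho(Frob_p) at almost all p; tree API FramedArtinRep Q 2, GaloisRep.frobTrace). This is the thesis
of card kronecker-rigidity-artin-type (Kronecker + conjugate temperedness => finite-order Satake
parameters; solvable unwinding by Langlands-Tunnell pieces LanglandsTunnell*.lean / Sarnak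
zbl:1035.11023, Brumley doi:10.1155/s1073792803206097) plus the INSOLUBLE (icosahedral) residue,
which no cyclic operation reaches (SolvableImageBarrier) - handed to the analytic cards
(artin-regime-heilbronn-blindness, Booker). Expected to be shared (wanted_by) with that card's route
when it opens; do not staff from here. -/
@[route_item "route-Langlands-RationalPeriodQuarter", crux]
def ArtinMatchingFromHeckeField : Prop :=
  (∀ N : ℕ, 0 < N → ∀ (χ : DirichletCharacter ℂ N) (u : UpperHalfPlane → ℂ), Literature.NumberTheory.Automorphic.IsC2 u → (∀ γ ∈ CongruenceSubgroup.Gamma0 N, ∀ z : UpperHalfPlane, u (γ • z) = χ ((((γ : Matrix (Fin 2) (Fin 2) ℤ) 1 1 : ℤ) : ZMod N)) * u z) → (∀ z : UpperHalfPlane, Literature.NumberTheory.Automorphic.hypLaplacian u z + (1 / 4 : ℂ) * u z = 0) → (∃ C : ℝ, ∀ z : UpperHalfPlane, ‖u z‖ ≤ C) → (∃ z, u z ≠ 0) → ∀ a : ℕ → ℂ, (∀ p : ℕ, p.Prime → ¬ p ∣ N → ∀ z : UpperHalfPlane, ∑ b ∈ Finset.range p, u (UpperHalfPlane.ofComplex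 (((z : ℂ) + b) / p)) + χ (p : ZMod N) * u (UpperHalfPlane.ofComplex ((p : ℂ) * (z : ℂ))) = ((Real.sqrt p : ℝ) : ℂ) * a p * u z) → ∃ E : IntermediateField ℚ ℂ, FiniteDimensional ℚ E ∧ ∀ p : ℕ, p.Prime → ¬ p ∣ N → a p ∈ E) → (∀ N : ℕ, 0 < N → ∀ (χ : DirichletCharacter ℂ N) (u : UpperHalfPlane → ℂ), Literature.NumberTheory.Automorphic.IsC2 u → (∀ γ ∈ CongruenceSubgroup.Gamma0 N, ∀ z : UpperHalfPlane, u (γ • z) = χ ((((γ : Matrix (Fin 2) (Fin 2) ℤ) 1 1 : ℤ) : ZMod N)) * u z) → (∀ z : UpperHalfPlane, Literature.NumberTheory.Automorphic.hypLaplacian u z + (1 / 4 : ℂ) * u z = 0) → (∃ C : ℝ, ∀ z : UpperHalfPlane, ‖u z‖ ≤ C) → (∃ z, u z ≠ 0) → ∀ a : ℕ → ℂ, (∀ p : ℕ, p.Prime → ¬ p ∣ N → ∀ z : UpperHalfPlane, ∑ b ∈ Finset.range p, u (UpperHalfPlane.ofComplex (((z : ℂ) + b) / p)) + χ (p : ZMod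 N) * u (UpperHalfPlane.ofComplex ((p : ℂ) * (z : ℂ))) = ((Real.sqrt p : ℝ) : ℂ) * a p * u z) → ∃ ρ : Literature.NumberTheory.GaloisRepresentations.FramedArtinRep ℚ 2, ∀ᶠ v : IsDedekindDomain.HeightOneSpectrum (NumberField.RingOfIntegers ℚ) in Filter.cofinite, ρ.toArtinRep.IsUnramifiedAt v ∧ a v.residueCard = ρ.toArtinRep.frobTrace v)

/-- item stmt-Langlands-2812 · support · rank 9 · open · by planner
sources: BuzzardGeeLMS2014
[support] UNCLAIMED COMPLEMENT - filed only to make the assembly end honestly in the summit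
constant. It packages (i) the passage from 'even Artin rho matching u at almost all p' to the
summit's typed Corresponds (l-adic avatar via iota, local-global compatibility at ALL places by
Henniart's gamma-factor characterisation, de Rham = finite image) for n=2, F=Q, pi_infinity of type
maassQuarterInfinityType, AND (ii) the entire rest of `Langlands` (all other n, F, infinity types,
direction (B)). Nobody should attempt it; its role is bookkeeping: Assembly is provable iff the
cruxes imply HeckeFieldQuarter. If the harness later grows a sector decomposition of the summit,
restate this item against it. -/
@[route_item "route-Langlands-RationalPeriodQuarter", crux]
def QuarterSectorToSummit : Prop :=
  (∀ N : ℕ, 0 < N → ∀ (χ : DirichletCharacter ℂ N) (u : UpperHalfPlane → ℂ), Literature.NumberTheory.Automorphic.IsC2 u → (∀ γ ∈ CongruenceSubgroup.Gamma0 N, ∀ z : UpperHalfPlane, u (γ • z) = χ ((((γ : Matrix (Fin 2) (Fin 2) ℤ) 1 1 : ℤ) : ZMod N)) * u z) → (∀ z : UpperHalfPlane, Literature.NumberTheory.Automorphic.hypLaplacian u z + (1 / 4 : ℂ) * u z = 0) → (∃ C : ℝ, ∀ z : UpperHalfPlane, ‖u z‖ ≤ C) → (∃ z, u z ≠ 0)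 → ∀ a : ℕ → ℂ, (∀ p : ℕ, p.Prime → ¬ p ∣ N → ∀ z : UpperHalfPlane, ∑ b ∈ Finset.range p, u (UpperHalfPlane.ofComplex (((z : ℂ) + b) / p)) + χ (p : ZMod N) * u (UpperHalfPlane.ofComplex ((p : ℂ) * (z : ℂ))) = ((Real.sqrt p : ℝ) : ℂ) * a p * u z) → ∃ ρ : Literature.NumberTheory.GaloisRepresentations.FramedArtinRep ℚ 2, ∀ᶠ v : IsDedekindDomain.HeightOneSpectrum (NumberField.RingOfIntegers ℚ) in Filter.cofinite, ρ.toArtinRep.IsUnramifiedAt v ∧ a v.residueCard = ρ.toArtinRep.frobTrace v) → _root_.Langlands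

/-- item stmt-Langlands-2813 · assembly · rank 1 · closed · proved by Summit.Langlands.Langlands.Theorems.rationalPeriodQuarter_assembly (planner) · by planner
sources: doi:10.1090/memo/1118
[assembly] PROOF PLAN (provable content: cruxes => HeckeFieldQuarter): given (N, chi, u, a) as in
the target, u lies in S = quarter cusp forms on Gamma_1(N) and T_p^chi u = T_{p,sigma} u. (1) S_Q :=
{v : HasRationalPeriodClass N v} is a Q-subspace (r^u is C-linear in u). (2) S_Q (x)_Q C -> S is
injective: if e_1..e_k in C are Q-independent and sum e_l w_l = 0 with w_l in S_Q, then sum e_l q_l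
= -d(sum e_l f_l) is PR_C-valued, so by SemiAnalyticRigidity sum e_l f_l = G in PR_C; apply the
coefficient-wise projection Pi_1 : PR_C = PR_Q (x) C -> PR_Q (pi_1(e_1)=1, pi_1(e_l)=0; commutes
with slashHalf) to get q_1 = -d(Pi_1 G), hence r^{w_1} = d(f_1 - Pi_1 G) and w_1 = 0 by
PeriodClassNontrivialQuarter. (3) RationalPeriodClassesQuarter: u = sum c_j v_j, v_j in S_Q, so u is
the image of a nonzero w in S_Q (x) C. (4) HeckePreservesRationalPeriods: T'_p :=
p^{-1/2}T_{p,sigma} restricts to Q-linear maps of S_Q and (T'_p (x) 1) w = a_p w by injectivity. (5)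
RationalEigencharacterLemma with V = S_Q gives a number field E containing all a_p:
HeckeFieldQuarter. (6) ArtinMatchingFromHeckeField, QuarterSectorToSummit => `Langlands` formally. -/
@[route_item "route-Langlands-RationalPeriodQuarter"]
def Assembly : Prop :=
  RationalPeriodClassesQuarter → PeriodClassNontrivialQuarter → SemiAnalyticRigidity → HeckePreservesRationalPeriods → RationalEigencharacterLemma → ArtinMatchingFromHeckeField → QuarterSectorToSummit → _root_.Langlands

-- `Assembly` holds: proved by `Summit.Langlands.Langlands.Theorems.rationalPeriodQuarter_assembly` (its module imports this route file, so no `_holds` link can be stated here).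

/-! D-0027 §2.1 — DECIDING THEOREM (planner-authored via `route open/edit --closes-file`; by planner-rbadge-Langlands-RationalPeriodQuarter-1a859168-g4-0 2026-08-15T16:20:09Z):
its hypotheses are this route's items and its conclusion the sub-problem Statement (glue_lint), and it elaborates with this file. -/

@[closes "route-Langlands-RationalPeriodQuarter"] theorem closes (h₁ : RationalPeriodClassesQuarter) (h₂ : PeriodClassNontrivialQuarter)
    (h₃ : SemiAnalyticRigidity) (h₄ : HeckePreservesRationalPeriods)
    (h₅ : HeckeFieldOfCruxes) (h₆ : ArtinMatchingFromHeckeField)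
    (h₇ : QuarterSectorToSummit) : _root_.Langlands :=
  h₇ (h₆ (h₅ h₁ h₂ h₃ h₄))

end Summit.Langlands.Langlands.Theses.RationalPeriodQuarter
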